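import Literature.Analysis.Complex.LaguerrePolya
import Mathlib.Analysis.Complex.Liouville
import Mathlib.Analysis.Complex.OpenMapping
import HarnessLib

/-!
# Jensen's theorem on the critical points of a real entire function of order `< 2`

Trunk T-ANALYSIS support (`Literature/Analysis/Complex`), serving the discharge of Kim's theorem
`Literature.Barriers.RiemannHypothesis.Farmer2022_kimTheorem` (Farmer 2022, §2; Kim 1996).

**Jensen's theorem** (Jensen 1913; Ki–Kim 2000, §2, p. 50, there for the class 𝔅 of real entire
functions of genus `1*` with finitely many non-real zeros): *if `z₁` is a non-real zero of `f'`,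
then there is a non-real zero `z₀` of `f` with `|z₁ − Re z₀| ≤ Im z₀`* — the non-real critical
points lie in the "Jensen discs", the discs having the segments `[z₀, z̄₀]` as diameters. Ki–Kim
derive it from the Hadamard product (2.1): off the real axis and outside all Jensen discs
`Im (f'/f) ≠ 0`, because `Im (1/(z − c) + 1/(z − c̄)) = −2 (Im z)(|z − Re c|² − (Im c)²)/(|z − c|²|z − c̄|²)`.

Here the theorem is PROVED for every real entire function of order `< 2` in the tree's quantitative
sense (`‖f(z)‖ ≤ C e^{‖z‖^ρ}`, `0 ≤ ρ < 2`, `f(ℝ) ⊆ ℝ`), with no restriction on the non-real zeros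
and *without* Hadamard factorisation: the tree's Titchmarsh engine
(`Literature.Analysis.Complex.titchmarsh_logDeriv_sub_sum`, as used in
`Literature/Analysis/Complex/LaguerrePolya.lean`) gives `f'/f = ∑_{|a−c|≤R} m(a)/(z − a) + ψ_R` on
`|z − c| < R` with `‖ψ_R'‖ ≪ R^{ρ−2} → 0`, hence `ψ_R(z) − ψ_R(z̄) → 0`; averaging the expansions
at `z` and `z̄` (Schwarz reflection) pairs every zero with its conjugate, whatever the
multiplicities, and yields the sign of `Im (f'/f)` outside the Jensen discs.

## Contents (all proved)

* `Literature.Analysis.Complex.exists_logDeriv_eq_sum_pair`: the two-point (`z`, `z̄`) form of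
  the approximation of `f'/f` by nearby zeros.
* `Literature.Analysis.Complex.im_mul_im_div_sub_add_div_sub_conj`: the displayed identity for a
  conjugate pair of poles.
* `Literature.Analysis.Complex.jensen_circle`: **Jensen's theorem** — for `f` real entire of order
  `< 2` with `f' ≢ 0`, every non-real zero `w` of `f'` satisfies `‖w − Re a‖ ≤ |Im a|` for some
  zero `a` of `f`; `jensen_circle_pos` picks `a` in the upper half-plane when `Im w > 0`.
* Closure of the class under differentiation (`norm_deriv_le_of_growth`,
  `exists_growth_iteratedDeriv`, `im_iteratedDeriv_ofReal`) and the iterated forms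
  `jensen_circle_iteratedDeriv_pos`, `abs_im_le_of_iteratedDeriv_eq_zero` (the zeros of all
  derivatives stay in the strip containing the zeros of `f`; Ki–Kim 2000, Remark 2.2 (b)).

## References

* J. L. W. V. Jensen, *Recherches sur la théorie des équations*, Acta Math. 36 (1913), 181–195
  (p. 190; cited through Ki–Kim 2000, §2).
* H. Ki, Y.-O. Kim, *On the number of nonreal zeros of real entire functions and the Fourier–Pólya
  conjecture*, Duke Math. J. 104 (2000), 45–73, §2 ("Jensen's theorem", p. 50; Remark 2.2 (b)).
* Y.-O. Kim, *Critical points of real entire functions and a conjecture of Pólya*, Proc. AMS 124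
  (1996), 819–830 (cited through Farmer 2022, §2).
* E. C. Titchmarsh, *The theory of the Riemann zeta-function*, 2nd ed., Oxford 1986, §3.9 Lemma α.
-/

noncomputable section

open Complex Filter Metric Set Topology
open scoped ComplexConjugate

namespace Literature.Analysis.Complex

variable {f : ℂ → ℂ}

/-! ## The logarithmic derivative at a pair of conjugate points -/

/-- **Approximation of `f'/f` by the nearby zeros, simultaneously at `z` and `z̄`.** Let `f` be
entire with `‖f‖ ≤ C e^{‖z‖^ρ}` (`0 ≤ ρ < 2`), `c ∈ ℝ` with `f(c) ≠ 0`, and `f(z) ≠ 0`,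
`f(z̄) ≠ 0`. For every `r` and `ε > 0` there are finitely many zeros `S ∋` (all zeros `a` with
`|a − c| ≤ r`), multiplicities `m ≥ 1`, and `ψ₁, ψ₂ ∈ ℂ` with
`f'/f(z) = ∑_{a ∈ S} m(a)/(z − a) + ψ₁`, `f'/f(z̄) = ∑_{a ∈ S} m(a)/(z̄ − a) + ψ₂` and
`‖ψ₁ − ψ₂‖ ≤ ε`. (Titchmarsh's Lemma α on `|w − c| < R`, `R → ∞`: `‖ψ_R'‖ ≤ 64((|c|+2R)^ρ + O(1))/R²`
on `|w − c| ≤ R/8`, and the mean value inequality between `z` and `z̄`.)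
[cite: Titchmarsh1986, §3.9 Lemma α] -/
theorem exists_logDeriv_eq_sum_pair (hf : Differentiable ℂ f) {ρ C : ℝ} (hρ0 : 0 ≤ ρ)
    (hρ : ρ < 2) (hgr : ∀ z, ‖f z‖ ≤ C * Real.exp (‖z‖ ^ ρ)) {c : ℝ} (hc : f c ≠ 0)
    {z : ℂ} (hz : f z ≠ 0) (hz' : f (conj z) ≠ 0) (r : ℝ) {ε : ℝ} (hε : 0 < ε) :
    ∃ (S : Finset ℂ) (m : ℂ → ℕ) (ψ₁ ψ₂ : ℂ), (∀ a ∈ S, f a = 0 ∧ 0 < m a) ∧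
      (∀ a, f a = 0 → ‖a - c‖ ≤ r → a ∈ S) ∧
      deriv f z / f z = ∑ a ∈ S, (m a : ℂ) / (z - a) + ψ₁ ∧
      deriv f (conj z) / f (conj z) = ∑ a ∈ S, (m a : ℂ) / (conj z - a) + ψ₂ ∧
      ‖ψ₁ - ψ₂‖ ≤ ε := by
  classical
  have hCpos : 0 < C := growthConst_pos hgr hc
  have hfc : 0 < ‖f (c : ℂ)‖ := norm_pos_iff.2 hc
  set d : ℝ := ‖z - c‖ with hd
  have hd' : ‖conj z - c‖ = d := by
    rw [hd, ← Complex.norm_conj (z - c), map_sub, Complex.conj_ofReal]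
  set K : ℝ := Real.log C - Real.log ‖f (c : ℂ)‖ + 1 with hK
  -- choose `R`
  have hlim : Tendsto (fun R : ℝ ↦ 64 * ((K + (|c| + 2 * R) ^ ρ) / R ^ 2) * (2 * d)) atTop
      (𝓝 0) := by
    simpa using ((tendsto_growth_div_sq K c hρ0 hρ).const_mul 64).mul_const (2 * d)
  obtain ⟨R, hRε, hRge⟩ := ((hlim.eventually_lt_const hε).and
    (eventually_ge_atTop (max (max |r| 1) (8 * d + 1)))).exists
  have hR1 : 1 ≤ R := ((le_max_right _ _).trans (le_max_left _ _)).trans hRge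
  have hRpos : 0 < R := by linarith
  have hRr : r ≤ R :=
    ((le_abs_self r).trans ((le_max_left _ _).trans (le_max_left _ _))).trans hRge
  have hRd : 8 * d + 1 ≤ R := (le_max_right _ _).trans hRge
  have hd0 : 0 ≤ d := norm_nonneg _
  -- Titchmarsh's lemma on `‖w - c‖ < R`
  set M : ℝ := C * Real.exp ((|c| + 2 * R) ^ ρ) with hM
  have hMball := norm_le_on_closedBall hρ0 hgr c R
  obtain ⟨S, m, ψ, hS, hS', hψd, hψeq, -, hψ'⟩ := titchmarsh_logDeriv_sub_sum hf hc hRpos hMball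
  have hlog : Real.log (M / ‖f (c : ℂ)‖) + 1 = K + (|c| + 2 * R) ^ ρ := by
    rw [hK, hM, Real.log_div (by positivity) hfc.ne', Real.log_mul hCpos.ne' (Real.exp_pos _).ne',
      Real.log_exp]
    ring
  have hcoef : 0 ≤ 64 * (Real.log (M / ‖f (c : ℂ)‖) + 1) / R ^ 2 := by
    have hfcM : ‖f (c : ℂ)‖ ≤ M := hMball c (mem_closedBall_self (by positivity))
    have : 0 ≤ Real.log (M / ‖f (c : ℂ)‖) := Real.log_nonneg ((one_le_div hfc).2 hfcM)
    positivity
  have hzball : z ∈ ball (c : ℂ) R := mem_ball_iff_norm.2 (by rw [← hd]; linarith)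
  have hz'ball : conj z ∈ ball (c : ℂ) R := mem_ball_iff_norm.2 (by rw [hd']; linarith)
  -- mean value estimate on the convex set `closedBall c (R/8)`, between `z̄` and `z`
  have hsub : closedBall (c : ℂ) (R / 8) ⊆ ball (c : ℂ) R := closedBall_subset_ball (by linarith)
  have hmv : ‖ψ z - ψ (conj z)‖ ≤
      64 * (Real.log (M / ‖f (c : ℂ)‖) + 1) / R ^ 2 * ‖z - conj z‖ := by
    refine (convex_closedBall (c : ℂ) (R / 8)).norm_image_sub_le_of_norm_deriv_le
      (fun w hw ↦ hψd.differentiableAt (isOpen_ball.mem_nhds (hsub hw))) (fun w hw ↦ hψ' w hw)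
      (mem_closedBall_iff_norm.2 ?_) (mem_closedBall_iff_norm.2 ?_)
    · rw [hd']; linarith
    · rw [← hd]; linarith
  have hzz : ‖z - conj z‖ ≤ 2 * d := by
    calc ‖z - conj z‖ = ‖(z - c) - (conj z - c)‖ := by ring_nf
      _ ≤ ‖z - c‖ + ‖conj z - c‖ := norm_sub_le _ _
      _ = 2 * d := by rw [← hd, hd']; ring
  refine ⟨S, m, ψ z, ψ (conj z), fun a ha ↦ ⟨(hS a ha).1, (hS a ha).2.1⟩,
    fun a ha har ↦ hS' a ha (har.trans hRr), ?_, ?_, ?_⟩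
  · rw [hψeq z hzball hz]; ring
  · rw [hψeq (conj z) hz'ball hz']; ring
  · calc ‖ψ z - ψ (conj z)‖
          ≤ 64 * (Real.log (M / ‖f (c : ℂ)‖) + 1) / R ^ 2 * ‖z - conj z‖ := hmv
      _ ≤ 64 * (Real.log (M / ‖f (c : ℂ)‖) + 1) / R ^ 2 * (2 * d) :=
          mul_le_mul_of_nonneg_left hzz hcoef
      _ = 64 * ((K + (|c| + 2 * R) ^ ρ) / R ^ 2) * (2 * d) := by rw [hlog]; ring
      _ ≤ ε := hRε.le

/-! ## The conjugate-pair identity -/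

/-- **The imaginary part of a conjugate pair of poles** (Ki–Kim 2000, §2, display before Jensen's
theorem): for `z ≠ a, ā`,
`(Im z) · Im (m/(z − a) + m/(z − ā)) = −2m (Im z)² (‖z − Re a‖² − (Im a)²)/(‖z − a‖² ‖z − ā‖²)`.
[cite: KiKim2000, §2 p. 49] -/
theorem im_mul_im_div_sub_add_div_sub_conj {a z : ℂ} (ha : z ≠ a) (ha' : z ≠ conj a) (m : ℕ) :
    z.im * ((m : ℂ) / (z - a) + (m : ℂ) / (z - conj a)).im =
      -(2 * m * z.im ^ 2 * (‖z - a.re‖ ^ 2 - a.im ^ 2) / (‖z - a‖ ^ 2 * ‖z - conj a‖ ^ 2)) := by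
  have h1 : ‖z - a‖ ^ 2 = (z.re - a.re) ^ 2 + (z.im - a.im) ^ 2 := by
    rw [← Complex.normSq_eq_norm_sq, Complex.normSq_apply]; simp; ring
  have h2 : ‖z - conj a‖ ^ 2 = (z.re - a.re) ^ 2 + (z.im + a.im) ^ 2 := by
    rw [← Complex.normSq_eq_norm_sq, Complex.normSq_apply]; simp; ring
  have h3 : ‖z - (a.re : ℂ)‖ ^ 2 = (z.re - a.re) ^ 2 + z.im ^ 2 := by
    rw [← Complex.normSq_eq_norm_sq, Complex.normSq_apply]; simp; ring
  have hD1 : (z.re - a.re) ^ 2 + (z.im - a.im) ^ 2 ≠ 0 := by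
    rw [← h1]; exact pow_ne_zero _ (norm_ne_zero_iff.2 (sub_ne_zero.2 ha))
  have hD2 : (z.re - a.re) ^ 2 + (z.im + a.im) ^ 2 ≠ 0 := by
    rw [← h2]; exact pow_ne_zero _ (norm_ne_zero_iff.2 (sub_ne_zero.2 ha'))
  have e1 : ((m : ℂ) / (z - a)).im = -(m * (z.im - a.im)) / ((z.re - a.re) ^ 2 + (z.im - a.im) ^ 2) := by
    rw [Complex.div_im, Complex.normSq_apply]
    simp
    ring
  have e2 : ((m : ℂ) / (z - conj a)).im =
      -(m * (z.im + a.im)) / ((z.re - a.re) ^ 2 + (z.im + a.im) ^ 2) := by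
    rw [Complex.div_im, Complex.normSq_apply]
    simp
    ring
  rw [Complex.add_im, e1, e2, h1, h2, h3]
  field_simp
  ring

/-- Sign of the conjugate-pair term outside the (open) Jensen disc: if `|Im a| < ‖z − Re a‖` then
`(Im z) · Im (m/(z − a) + m/(z − ā)) ≤ 0`. [cite: KiKim2000, §2 p. 50] -/
theorem im_mul_im_pair_nonpos {a z : ℂ} (h : |a.im| < ‖z - a.re‖) (m : ℕ) :
    z.im * ((m : ℂ) / (z - a) + (m : ℂ) / (z - conj a)).im ≤ 0 := by
  have hza : z ≠ a := by
    rintro rfl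
    have : ‖z - (z.re : ℂ)‖ = |z.im| := by
      have e : z - (z.re : ℂ) = (z.im : ℂ) * I := by apply Complex.ext <;> simp
      rw [e, norm_mul, Complex.norm_I, mul_one, Complex.norm_real, Real.norm_eq_abs]
    rw [this] at h
    exact lt_irrefl _ h
  have hza' : z ≠ conj a := by
    rintro rfl
    have e : conj a - (a.re : ℂ) = -((a.im : ℂ) * I) := by apply Complex.ext <;> simp
    rw [e, norm_neg, norm_mul, Complex.norm_I, mul_one, Complex.norm_real, Real.norm_eq_abs] at h
    exact lt_irrefl _ h
  rw [im_mul_im_div_sub_add_div_sub_conj hza hza' m, neg_nonpos]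
  have hsq : a.im ^ 2 ≤ ‖z - a.re‖ ^ 2 := by
    calc a.im ^ 2 = |a.im| ^ 2 := (sq_abs _).symm
      _ ≤ ‖z - a.re‖ ^ 2 := pow_le_pow_left₀ (abs_nonneg _) h.le 2
  have : 0 ≤ ‖z - a.re‖ ^ 2 - a.im ^ 2 := sub_nonneg.2 hsq
  positivity

/-- Strict sign of the conjugate-pair term: if `|Im a| < ‖z − Re a‖`, `Im z ≠ 0` and `m ≥ 1`, then
`(Im z) · Im (m/(z − a) + m/(z − ā)) ≤ −κ` with the explicit
`κ = 2 (Im z)² (‖z − Re a‖² − (Im a)²)/(‖z − a‖² ‖z − ā‖²) > 0` (independent of `m`).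
[cite: KiKim2000, §2 p. 50] -/
theorem im_mul_im_pair_le {a z : ℂ} (h : |a.im| < ‖z - a.re‖) (hz : z.im ≠ 0) {m : ℕ}
    (hm : 1 ≤ m) :
    z.im * ((m : ℂ) / (z - a) + (m : ℂ) / (z - conj a)).im ≤
        -(2 * z.im ^ 2 * (‖z - a.re‖ ^ 2 - a.im ^ 2) / (‖z - a‖ ^ 2 * ‖z - conj a‖ ^ 2)) ∧
      0 < 2 * z.im ^ 2 * (‖z - a.re‖ ^ 2 - a.im ^ 2) / (‖z - a‖ ^ 2 * ‖z - conj a‖ ^ 2) := by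
  have hza : z ≠ a := by
    rintro rfl
    have : ‖z - (z.re : ℂ)‖ = |z.im| := by
      have e : z - (z.re : ℂ) = (z.im : ℂ) * I := by apply Complex.ext <;> simp
      rw [e, norm_mul, Complex.norm_I, mul_one, Complex.norm_real, Real.norm_eq_abs]
    rw [this] at h
    exact lt_irrefl _ h
  have hza' : z ≠ conj a := by
    rintro rfl
    have e : conj a - (a.re : ℂ) = -((a.im : ℂ) * I) := by apply Complex.ext <;> simp
    rw [e, norm_neg, norm_mul, Complex.norm_I, mul_one, Complex.norm_real, Real.norm_eq_abs] at h
    exact lt_irrefl _ h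
  have hsq : a.im ^ 2 < ‖z - a.re‖ ^ 2 := by
    calc a.im ^ 2 = |a.im| ^ 2 := (sq_abs _).symm
      _ < ‖z - a.re‖ ^ 2 := pow_lt_pow_left₀ h (abs_nonneg _) two_ne_zero
  have hpos : 0 < ‖z - a.re‖ ^ 2 - a.im ^ 2 := sub_pos.2 hsq
  have hn1 : 0 < ‖z - a‖ ^ 2 := by
    have := norm_pos_iff.2 (sub_ne_zero.2 hza); positivity
  have hn2 : 0 < ‖z - conj a‖ ^ 2 := by
    have := norm_pos_iff.2 (sub_ne_zero.2 hza'); positivity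
  have hzim : 0 < z.im ^ 2 := by positivity
  refine ⟨?_, by positivity⟩
  rw [im_mul_im_div_sub_add_div_sub_conj hza hza' m, neg_le_neg_iff,
    div_le_div_iff_of_pos_right (by positivity)]
  have hm' : (1 : ℝ) ≤ m := by exact_mod_cast hm
  nlinarith [mul_pos hzim hpos]

/-! ## Jensen's theorem -/

/-- Reflection for the logarithmic derivative of a real entire function:
`f'/f(z̄) = conj (f'/f(z))`. [folklore] -/
theorem logDeriv_apply_conj (hf : Differentiable ℂ f) (hreal : ∀ x : ℝ, (f x).im = 0) (z : ℂ) :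
    deriv f (conj z) / f (conj z) = conj (deriv f z / f z) := by
  have hreal' : ∀ x : ℝ, (deriv f x).im = 0 := im_deriv_ofReal hf hreal
  rw [map_div₀, apply_conj_eq_conj hf hreal, apply_conj_eq_conj hf.deriv hreal']

/-- A zero-free real entire function of order `< 2` has constant logarithmic derivative: if
moreover `f'(w) = 0` at one point then `f' ≡ 0`. (For zero-free `f` the pair expansion gives
`f'/f(z) = f'/f(z̄) = conj f'/f(z)`, so `f'/f` is a real-valued entire function, constant by the
open mapping theorem.) [folklore] -/
theorem deriv_eq_zero_of_forall_ne_zero (hf : Differentiable ℂ f) {ρ C : ℝ} (hρ0 : 0 ≤ ρ)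
    (hρ : ρ < 2) (hgr : ∀ z, ‖f z‖ ≤ C * Real.exp (‖z‖ ^ ρ)) (hreal : ∀ x : ℝ, (f x).im = 0)
    (hne : ∀ z, f z ≠ 0) {w : ℂ} (hfw : deriv f w = 0) (z : ℂ) : deriv f z = 0 := by
  set g : ℂ → ℂ := fun z ↦ deriv f z / f z with hg
  -- `g` is real-valued
  have him : ∀ z, (g z).im = 0 := by
    intro z
    have key : ∀ ε : ℝ, 0 < ε → ‖g z - conj (g z)‖ ≤ ε := by
      intro ε hε
      obtain ⟨S, m, ψ₁, ψ₂, hS, -, h1, h2, hψ⟩ :=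
        exists_logDeriv_eq_sum_pair hf hρ0 hρ hgr (hne 0) (hne z) (hne _) 0 hε
      have hS0 : S = ∅ := Finset.eq_empty_of_forall_notMem fun a ha ↦ hne a (hS a ha).1
      rw [hS0, Finset.sum_empty, zero_add] at h1 h2
      have h3 : conj (g z) = ψ₂ := by
        rw [hg]; dsimp only; rw [← logDeriv_apply_conj hf hreal z, h2]
      rw [h3, show g z = ψ₁ from h1]
      exact hψ
    have h0 : g z - conj (g z) = 0 := by
      refine norm_le_zero_iff.1 (le_of_forall_pos_le_add fun ε hε ↦ ?_)
      simpa using key ε hε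
    have := congrArg Complex.im h0
    simp only [Complex.sub_im, Complex.conj_im, sub_neg_eq_add, Complex.zero_im] at this
    linarith
  -- hence constant, by the open mapping theorem
  have hgd : Differentiable ℂ g := fun z ↦ (hf.deriv z).div (hf z) (hne z)
  have hga : AnalyticOnNhd ℂ g univ := hgd.differentiableOn.analyticOnNhd isOpen_univ
  have hconst : ∀ z, g z = g w := by
    rcases hga.is_constant_or_isOpenMap with ⟨c, hc⟩ | hopen
    · intro z; rw [hc z, hc w]
    · exfalso
      have hU : IsOpen (g '' univ) := by simpa using hopen univ isOpen_univ
      obtain ⟨δ, hδ, hball⟩ := Metric.isOpen_iff.1 hU (g 0) ⟨0, mem_univ _, rfl⟩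
      have hmem : g 0 + I * (δ / 2 : ℝ) ∈ ball (g 0) δ := by
        rw [mem_ball_iff_norm]
        have : ‖I * ((δ / 2 : ℝ) : ℂ)‖ = δ / 2 := by
          rw [norm_mul, Complex.norm_I, one_mul, Complex.norm_real, Real.norm_eq_abs,
            abs_of_pos (by positivity)]
        simp only [add_sub_cancel_left, this]
        linarith
      obtain ⟨u, -, hu⟩ := hball hmem
      have := him u
      rw [hu] at this
      simp [him 0] at this
      exact hδ.ne' this
  have hgz : g z = 0 := by rw [hconst z, hg]; simp [hfw]
  have : deriv f z / f z = 0 := hgz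
  rcases div_eq_zero_iff.1 this with h | h
  · exact h
  · exact absurd h (hne z)

/-- **Jensen's theorem (critical points of real entire functions; Jensen 1913, Ki–Kim 2000 §2
p. 50), for order `< 2`.** Let `f` be entire with `‖f(z)‖ ≤ C e^{‖z‖^ρ}` (`0 ≤ ρ < 2`), real on
the real axis, with `f' ≢ 0`. If `w` is a non-real zero of `f'`, then there is a zero `a` of `f`
with `‖w − Re a‖ ≤ |Im a|` (so `a` is non-real and `w` lies in the closed disc with diameter
`[ā, a]`). Ki–Kim state it for genus `1*` with finitely many non-real zeros, via the Hadamard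
product; the proof here pairs the zeros through the expansions of `f'/f` at `w` and `w̄`
(`exists_logDeriv_eq_sum_pair`), so no finiteness of the non-real zeros is needed.
[cite: KiKim2000, §2 p. 50 (Jensen's theorem)] -/
theorem jensen_circle (hf : Differentiable ℂ f) {ρ C : ℝ} (hρ0 : 0 ≤ ρ) (hρ : ρ < 2)
    (hgr : ∀ z, ‖f z‖ ≤ C * Real.exp (‖z‖ ^ ρ)) (hreal : ∀ x : ℝ, (f x).im = 0)
    (hf' : ∃ z, deriv f z ≠ 0) {w : ℂ} (hw : w.im ≠ 0) (hfw : deriv f w = 0) :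
    ∃ a : ℂ, f a = 0 ∧ ‖w - a.re‖ ≤ |a.im| := by
  classical
  by_contra hcon
  push Not at hcon
  -- `f w ≠ 0`
  have hfw0 : f w ≠ 0 := by
    intro h0
    have h := hcon w h0
    have e : w - (w.re : ℂ) = (w.im : ℂ) * I := by apply Complex.ext <;> simp
    rw [e, norm_mul, Complex.norm_I, mul_one, Complex.norm_real, Real.norm_eq_abs] at h
    exact lt_irrefl _ h
  have hfw0' : f (conj w) ≠ 0 := by
    rw [apply_conj_eq_conj hf hreal, map_ne_zero]; exact hfw0
  by_cases hex : ∃ a, f a = 0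
  · obtain ⟨a₀, ha₀⟩ := hex
    obtain ⟨c, hc⟩ := exists_ofReal_ne_zero hf ⟨w, hfw0⟩
    -- the fixed negative contribution of `a₀`
    obtain ⟨-, hκ⟩ := im_mul_im_pair_le (hcon a₀ ha₀) hw (le_refl 1)
    set κ : ℝ := 2 * w.im ^ 2 * (‖w - a₀.re‖ ^ 2 - a₀.im ^ 2) /
      (‖w - a₀‖ ^ 2 * ‖w - conj a₀‖ ^ 2) with hκdef
    have hε : 0 < κ / (|w.im| + 1) := by positivity
    obtain ⟨S, m, ψ₁, ψ₂, hS, hS', h1, h2, hψ⟩ :=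
      exists_logDeriv_eq_sum_pair hf hρ0 hρ hgr hc hfw0 hfw0' ‖a₀ - c‖ hε
    have ha₀S : a₀ ∈ S := hS' a₀ ha₀ le_rfl
    -- `f'/f` vanishes at `w` and at `w̄`
    have hg1 : deriv f w / f w = 0 := by rw [hfw, zero_div]
    have hg2 : deriv f (conj w) / f (conj w) = 0 := by
      rw [logDeriv_apply_conj hf hreal, hg1, map_zero]
    rw [hg1] at h1
    rw [hg2] at h2
    -- conjugate the second expansion: `0 = ∑ m(a)/(w - ā) + conj ψ₂`
    have h2' : (0 : ℂ) = ∑ a ∈ S, (m a : ℂ) / (w - conj a) + conj ψ₂ := by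
      have := congrArg conj h2
      rw [map_zero, map_add, map_sum] at this
      rw [this]
      congr 1
      refine Finset.sum_congr rfl fun a _ ↦ ?_
      rw [map_div₀, map_natCast, map_sub, Complex.conj_conj]
    -- add up and take `(Im w) · Im`
    have hsum : ∑ a ∈ S, w.im * ((m a : ℂ) / (w - a) + (m a : ℂ) / (w - conj a)).im =
        w.im * (ψ₂.im - ψ₁.im) := by
      have e : ∑ a ∈ S, ((m a : ℂ) / (w - a) + (m a : ℂ) / (w - conj a)) = -(ψ₁ + conj ψ₂) := by
        rw [Finset.sum_add_distrib]
        have e1 : ∑ a ∈ S, (m a : ℂ) / (w - a) = -ψ₁ := eq_neg_of_add_eq_zero_left h1.symm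
        have e2 : ∑ a ∈ S, (m a : ℂ) / (w - conj a) = -conj ψ₂ :=
          eq_neg_of_add_eq_zero_left h2'.symm
        rw [e1, e2]; ring
      rw [← Finset.mul_sum, ← Complex.im_sum, e]
      simp only [Complex.neg_im, Complex.add_im, Complex.conj_im]
      ring
    have hle : ∑ a ∈ S, w.im * ((m a : ℂ) / (w - a) + (m a : ℂ) / (w - conj a)).im ≤ -κ := by
      rw [← Finset.add_sum_erase S _ ha₀S]
      have hrest : ∑ a ∈ S.erase a₀, w.im * ((m a : ℂ) / (w - a) + (m a : ℂ) / (w - conj a)).im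
          ≤ 0 :=
        Finset.sum_nonpos fun a ha ↦
          im_mul_im_pair_nonpos (hcon a (hS a (Finset.mem_of_mem_erase ha)).1) (m a)
      have hfirst := (im_mul_im_pair_le (hcon a₀ ha₀) hw (hS a₀ ha₀S).2).1
      rw [← hκdef] at hfirst
      linarith
    have hψim : |ψ₂.im - ψ₁.im| ≤ κ / (|w.im| + 1) := by
      calc |ψ₂.im - ψ₁.im| = |(ψ₁ - ψ₂).im| := by rw [Complex.sub_im, abs_sub_comm]
        _ ≤ ‖ψ₁ - ψ₂‖ := Complex.abs_im_le_norm _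
        _ ≤ κ / (|w.im| + 1) := hψ
    have hprod : |w.im * (ψ₂.im - ψ₁.im)| ≤ |w.im| * (κ / (|w.im| + 1)) := by
      rw [abs_mul]; exact mul_le_mul_of_nonneg_left hψim (abs_nonneg _)
    have hlt : |w.im| * (κ / (|w.im| + 1)) < κ := by
      rw [← mul_div_assoc, div_lt_iff₀ (by positivity)]
      nlinarith [abs_nonneg w.im]
    have := neg_abs_le (w.im * (ψ₂.im - ψ₁.im))
    rw [hsum] at hle
    linarith
  · push Not at hex
    obtain ⟨z, hz⟩ := hf'
    exact hz (deriv_eq_zero_of_forall_ne_zero hf hρ0 hρ hgr hreal hex hfw z)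

/-- **Jensen's theorem, upper half-plane form.** Under the hypotheses of `jensen_circle`, a zero
`w` of `f'` with `Im w > 0` lies in the Jensen disc of a zero `a` of `f` with `Im a > 0`:
`(Re w − Re a)² + (Im w)² ≤ (Im a)²`; in particular `Im w ≤ Im a`.
[cite: KiKim2000, §2 p. 50 (Jensen's theorem)] -/
theorem jensen_circle_pos (hf : Differentiable ℂ f) {ρ C : ℝ} (hρ0 : 0 ≤ ρ) (hρ : ρ < 2)
    (hgr : ∀ z, ‖f z‖ ≤ C * Real.exp (‖z‖ ^ ρ)) (hreal : ∀ x : ℝ, (f x).im = 0)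
    (hf' : ∃ z, deriv f z ≠ 0) {w : ℂ} (hw : 0 < w.im) (hfw : deriv f w = 0) :
    ∃ a : ℂ, f a = 0 ∧ 0 < a.im ∧ (w.re - a.re) ^ 2 + w.im ^ 2 ≤ a.im ^ 2 := by
  obtain ⟨a, ha, hwa⟩ := jensen_circle hf hρ0 hρ hgr hreal hf' hw.ne' hfw
  have hsq : (w.re - a.re) ^ 2 + w.im ^ 2 ≤ a.im ^ 2 := by
    have e : ‖w - a.re‖ ^ 2 = (w.re - a.re) ^ 2 + w.im ^ 2 := by
      rw [← Complex.normSq_eq_norm_sq, Complex.normSq_apply]; simp; ring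
    calc (w.re - a.re) ^ 2 + w.im ^ 2 = ‖w - a.re‖ ^ 2 := e.symm
      _ ≤ |a.im| ^ 2 := pow_le_pow_left₀ (norm_nonneg _) hwa 2
      _ = a.im ^ 2 := sq_abs _
  have ha0 : a.im ≠ 0 := by
    intro h0
    rw [h0] at hsq
    nlinarith [sq_nonneg (w.re - a.re)]
  rcases lt_or_gt_of_ne ha0 with hneg | hpos
  · refine ⟨conj a, ?_, by simpa using hneg, by simpa using hsq⟩
    rw [apply_conj_eq_conj hf hreal, ha, map_zero]
  · exact ⟨a, ha, hpos, hsq⟩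

/-! ## Closure of the class under differentiation -/

/-- **Growth of the derivative**: if `‖f(z)‖ ≤ C e^{‖z‖^ρ}` (`0 ≤ ρ < 2`) then
`‖f'(z)‖ ≤ C' e^{‖z‖^{ρ'}}` with `ρ' = (ρ + 2)/2 < 2` (Cauchy's estimate on the circle of radius `1`
about `z`). [folklore] -/
theorem norm_deriv_le_of_growth (hf : Differentiable ℂ f) {ρ C : ℝ} (hρ0 : 0 ≤ ρ) (hρ : ρ < 2)
    (hgr : ∀ z, ‖f z‖ ≤ C * Real.exp (‖z‖ ^ ρ)) :
    ∃ C' : ℝ, ∀ z, ‖deriv f z‖ ≤ C' * Real.exp (‖z‖ ^ ((ρ + 2) / 2)) := by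
  obtain ⟨K, -, hK⟩ := exists_add_rpow_le ρ 1 hρ0 hρ zero_le_one
  have hC := growthConst_nonneg hgr
  refine ⟨C * Real.exp K, fun z ↦ ?_⟩
  have h1 : ‖deriv f z‖ ≤ C * Real.exp K * Real.exp (‖z‖ ^ ((ρ + 2) / 2)) / 1 := by
    refine Complex.norm_deriv_le_of_forall_mem_sphere_norm_le zero_lt_one hf.diffContOnCl ?_
    intro u hu
    have hu' : ‖u‖ ≤ ‖z‖ + 1 := by
      have : ‖u - z‖ = 1 := mem_sphere_iff_norm.1 hu
      calc ‖u‖ = ‖(u - z) + z‖ := by ring_nf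
        _ ≤ ‖u - z‖ + ‖z‖ := norm_add_le _ _
        _ = ‖z‖ + 1 := by rw [this, add_comm]
    refine (hgr u).trans ?_
    rw [mul_assoc, ← Real.exp_add]
    gcongr
    calc ‖u‖ ^ ρ ≤ (‖z‖ + 1) ^ ρ := Real.rpow_le_rpow (norm_nonneg _) hu' hρ0
      _ ≤ K + ‖z‖ ^ ((ρ + 2) / 2) := hK ‖z‖ (norm_nonneg _)
  simpa using h1

/-- The iterated derivatives of an entire function are entire. [folklore] -/
theorem differentiable_iteratedDeriv_of_entire (hf : Differentiable ℂ f) (k : ℕ) :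
    Differentiable ℂ (iteratedDeriv k f) := by
  induction k with
  | zero => simpa using hf
  | succ k ih => rw [iteratedDeriv_succ]; exact ih.deriv

/-- The iterated derivatives of a real entire function are real on the real axis. [folklore] -/
theorem im_iteratedDeriv_ofReal (hf : Differentiable ℂ f) (hreal : ∀ x : ℝ, (f x).im = 0)
    (k : ℕ) (x : ℝ) : (iteratedDeriv k f x).im = 0 := by
  induction k generalizing x with
  | zero => simpa using hreal x
  | succ k ih =>
    rw [iteratedDeriv_succ]
    exact im_deriv_ofReal (differentiable_iteratedDeriv_of_entire hf k) ih x

/-- **Every derivative of an entire function of order `< 2` has order `< 2`** (in the tree's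
quantitative sense, with some exponent `0 ≤ ρ_k < 2`). [folklore] -/
theorem exists_growth_iteratedDeriv (hf : Differentiable ℂ f) {ρ C : ℝ} (hρ0 : 0 ≤ ρ)
    (hρ : ρ < 2) (hgr : ∀ z, ‖f z‖ ≤ C * Real.exp (‖z‖ ^ ρ)) (k : ℕ) :
    ∃ ρ' C' : ℝ, 0 ≤ ρ' ∧ ρ' < 2 ∧ ∀ z, ‖iteratedDeriv k f z‖ ≤ C' * Real.exp (‖z‖ ^ ρ') := by
  induction k with
  | zero => exact ⟨ρ, C, hρ0, hρ, by simpa using hgr⟩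
  | succ k ih =>
    obtain ⟨ρ', C', hρ'0, hρ', hgr'⟩ := ih
    obtain ⟨C'', h⟩ :=
      norm_deriv_le_of_growth (differentiable_iteratedDeriv_of_entire hf k) hρ'0 hρ' hgr'
    refine ⟨(ρ' + 2) / 2, C'', by positivity, by linarith, fun z ↦ ?_⟩
    rw [iteratedDeriv_succ]
    exact h z

/-- **Jensen's theorem for the iterated derivatives.** Let `f` be real entire of order `< 2`
with no derivative vanishing identically. If `w` with `Im w > 0` is a zero of `f^{(k+1)}`, then
`(Re w − Re a)² + (Im w)² ≤ (Im a)²` for some zero `a` of `f^{(k)}` with `Im a > 0`.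
[cite: KiKim2000, §2 p. 50 (Jensen's theorem)] -/
theorem jensen_circle_iteratedDeriv_pos (hf : Differentiable ℂ f) {ρ C : ℝ} (hρ0 : 0 ≤ ρ)
    (hρ : ρ < 2) (hgr : ∀ z, ‖f z‖ ≤ C * Real.exp (‖z‖ ^ ρ)) (hreal : ∀ x : ℝ, (f x).im = 0)
    (hnz : ∀ n : ℕ, iteratedDeriv n f ≠ 0) (k : ℕ) {w : ℂ} (hw : 0 < w.im)
    (hfw : iteratedDeriv (k + 1) f w = 0) :
    ∃ a : ℂ, iteratedDeriv k f a = 0 ∧ 0 < a.im ∧ (w.re - a.re) ^ 2 + w.im ^ 2 ≤ a.im ^ 2 := by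
  obtain ⟨ρ', C', hρ'0, hρ', hgr'⟩ := exists_growth_iteratedDeriv hf hρ0 hρ hgr k
  have hf' : ∃ z, deriv (iteratedDeriv k f) z ≠ 0 := by
    rw [← iteratedDeriv_succ]
    exact Function.ne_iff.1 (hnz (k + 1))
  rw [iteratedDeriv_succ] at hfw
  exact jensen_circle_pos (differentiable_iteratedDeriv_of_entire hf k) hρ'0 hρ' hgr'
    (im_iteratedDeriv_ofReal hf hreal k) hf' hw hfw

/-- **The zeros of all derivatives stay in the strip** (Ki–Kim 2000, Remark 2.2 (b), for the
functions considered here): if `f` is real entire of order `< 2`, no derivative of `f` vanishes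
identically, and all zeros of `f` satisfy `|Im z| ≤ Δ` (`Δ ≥ 0`), then so do all zeros of every
`f^{(k)}`. [cite: KiKim2000, §2 Remark 2.2 (b)] -/
theorem abs_im_le_of_iteratedDeriv_eq_zero (hf : Differentiable ℂ f) {ρ C : ℝ} (hρ0 : 0 ≤ ρ)
    (hρ : ρ < 2) (hgr : ∀ z, ‖f z‖ ≤ C * Real.exp (‖z‖ ^ ρ)) (hreal : ∀ x : ℝ, (f x).im = 0)
    (hnz : ∀ n : ℕ, iteratedDeriv n f ≠ 0) {Δ : ℝ} (hΔ : 0 ≤ Δ)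
    (hstrip : ∀ z, f z = 0 → |z.im| ≤ Δ) (k : ℕ) {z : ℂ} (hz : iteratedDeriv k f z = 0) :
    |z.im| ≤ Δ := by
  induction k generalizing z with
  | zero => exact hstrip z (by simpa using hz)
  | succ k ih =>
    -- reduce to `Im z > 0` by reflection
    have hrefl : ∀ u : ℂ, iteratedDeriv (k + 1) f (conj u) = conj (iteratedDeriv (k + 1) f u) :=
      fun u ↦ apply_conj_eq_conj (differentiable_iteratedDeriv_of_entire hf (k + 1))
        (im_iteratedDeriv_ofReal hf hreal (k + 1)) u
    have key : ∀ u : ℂ, 0 < u.im → iteratedDeriv (k + 1) f u = 0 → |u.im| ≤ Δ := by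
      intro u hu hfu
      obtain ⟨a, ha, ha0, hdisc⟩ := jensen_circle_iteratedDeriv_pos hf hρ0 hρ hgr hreal hnz k hu hfu
      have h1 := ih ha
      rw [abs_of_pos hu]
      rw [abs_of_pos ha0] at h1
      nlinarith [sq_nonneg (u.re - a.re)]
    rcases lt_trichotomy z.im 0 with hneg | h0 | hpos
    · have h := key (conj z) (by simpa using hneg) (by rw [hrefl, hz, map_zero])
      simpa using h
    · rw [h0, abs_zero]; exact hΔ
    · exact key z hpos hz

end Literature.Analysis.Complex
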